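import Literature.Topology.PlaneTopology.LoopGates
import Literature.Topology.PlaneTopology.Rectangles
import Literature.Topology.PlaneTopology.JordanNesting
import Mathlib.Topology.Connected.LocallyPathConnected
import HarnessLib

/-!
# Germ regions of a Jordan domain about a boundary point (box cross-cuts, chamber decomposition, nesting)

Topic: Topology / PlaneTopology (sequel to `LoopGates.lean`). For a Jordan domain `D`, a boundary
point `b ∈ ∂D` and a radius `s`, let `Q = boxJD b s` be the open sup-norm box of radius `s` about
`b` (a Jordan domain, `Rectangles.rect`) and `G` the **germ chamber**, the component of
`D ∩ box b s` containing a base point `g ∈ D` near `b`. Every point of `D` outside `G` hangs off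
exactly one gate of `G` (a gate of `D` on `∂Q` lying in the frontier of `G`): `D` is the disjoint
union of `G`, the gates of `G`, and their far sides (`mem_gateFar_of_not_mem`,
`disjoint_gateFar_of_ne`). In particular a far point `o ∈ D` off the closed box determines a
unique gate `S = germGate` of `G` whose far side contains `o`; its near side `U = germRegion`
(the component of `g` in `D ∖ S`) is the **germ region** of `D` at `b` at scale `s`: an open
connected subset of `D` containing `G`, whose frontier inside `D` is exactly the gate `S ⊆ ∂Q`,
whose frontier is `S̄ ∪ α` for the arc `α ∋ b` of `∂D` between the gate ends, which is contained in
a small ball about `b` when `s` is small (`germRegion_subset_closedBall`), and which is MONOTONE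
in `s` (`germRegion_mono`). These are the regions `Θ(r)` ("the part of `Ω` on `b`'s side of the
first arc `S_o(b,r)` of `∂B(b,r) ∩ Ω` crossed by paths from `o`") of Chelkak–Wan 2021, §3.2, in
which boundary Harnack estimates for lattice harmonic functions are iterated; boxes replace discs.

Main statements: `isPreconnected_box_diff_closedBox` (outer half-neighbourhoods of the square are
connected), `twoOff_boxJD`, `chamber`, `box_inter_box_subset_chamber`, `IsGateOf`,
`gate_subset_frontier_chamber`, `mem_gate_of_mem_closure_chamber`, `box_diff_closedBox_subset_gateFar`,
`mem_gateFar_of_not_mem` (decomposition), `disjoint_gateFar_of_ne`, `germGateParam`/`germGate`/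
`germRegion` and their properties, `germRegion_mono` (nesting), `germRegion_subset_closedBall`,
`ball_inter_subset_chamber` (ULC germ). Everything is proved.

## References
* D. Chelkak, Y. Wan, *On the convergence of massive loop-erased random walks to massive SLE(2)
  curves*, Electron. J. Probab. 26 (2021), §3.2 (regions `Ω_o(b,r)`, arcs `S_o(b,r)`). [ChelkakWan2021]
* M. H. A. Newman, *Elements of the topology of plane sets of points* (1939), Ch. V §11. [Newman1939]
-/

noncomputable section

/-! ## Germ regions about a boundary point (boxes) -/

namespace Literature.Topology.PlaneTopology

open Set Metric Filter Complex _root_.Topology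
open Literature.Probability.RandomPlanarGeometry (JordanDomain)
open Literature.Probability.RandomPlanarGeometry.JordanDomain

/-! ### Open sup-norm boxes -/

/-- The open sup-norm box of radius `s` about `b`. [folklore] -/
def box (b : ℂ) (s : ℝ) : Set ℂ := Ioo (b.re - s) (b.re + s) ×ℂ Ioo (b.im - s) (b.im + s)

/-- The closed sup-norm box of radius `s` about `b`. [folklore] -/
def closedBox (b : ℂ) (s : ℝ) : Set ℂ := Icc (b.re - s) (b.re + s) ×ℂ Icc (b.im - s) (b.im + s)

/-- Membership in the open box. [folklore] -/
theorem mem_box {b z : ℂ} {s : ℝ} :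
    z ∈ box b s ↔ b.re - s < z.re ∧ z.re < b.re + s ∧ b.im - s < z.im ∧ z.im < b.im + s := by
  simp only [box, mem_reProdIm, mem_Ioo, and_assoc]

/-- Membership in the closed box. [folklore] -/
theorem mem_closedBox {b z : ℂ} {s : ℝ} :
    z ∈ closedBox b s ↔ b.re - s ≤ z.re ∧ z.re ≤ b.re + s ∧ b.im - s ≤ z.im ∧ z.im ≤ b.im + s := by
  simp only [closedBox, mem_reProdIm, mem_Icc, and_assoc]

/-- Membership in the open box via absolute values. [folklore] -/
theorem mem_box_iff_abs {b z : ℂ} {s : ℝ} : z ∈ box b s ↔ |z.re - b.re| < s ∧ |z.im - b.im| < s := by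
  rw [mem_box, abs_lt, abs_lt]
  constructor
  · rintro ⟨h1, h2, h3, h4⟩; exact ⟨⟨by linarith, by linarith⟩, by linarith, by linarith⟩
  · rintro ⟨⟨h1, h2⟩, h3, h4⟩; exact ⟨by linarith, by linarith, by linarith, by linarith⟩

/-- The open box via strict coordinate inequalities (set-builder form). [folklore] -/
theorem box_eq_inter (b : ℂ) (s : ℝ) : box b s =
    {z : ℂ | b.re - s < z.re} ∩ {z | z.re < b.re + s} ∩ ({z | b.im - s < z.im} ∩ {z | z.im < b.im + s}) := by
  ext z; simp only [mem_box, mem_inter_iff, mem_setOf_eq, and_assoc]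

/-- Open boxes are open. [folklore] -/
theorem isOpen_box (b : ℂ) (s : ℝ) : IsOpen (box b s) := isOpen_Ioo.reProdIm isOpen_Ioo

/-- Closed boxes are closed. [folklore] -/
theorem isClosed_closedBox (b : ℂ) (s : ℝ) : IsClosed (closedBox b s) := isClosed_Icc.reProdIm isClosed_Icc

/-- The open box lies in the closed box. [folklore] -/
theorem box_subset_closedBox (b : ℂ) (s : ℝ) : box b s ⊆ closedBox b s := fun z hz => by
  rw [mem_box] at hz; rw [mem_closedBox]; exact ⟨hz.1.le, hz.2.1.le, hz.2.2.1.le, hz.2.2.2.le⟩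

/-- Boxes are convex. [folklore] -/
theorem convex_box (b : ℂ) (s : ℝ) : Convex ℝ (box b s) := by
  rw [box_eq_inter]
  exact ((convex_halfSpace_re_gt _).inter (convex_halfSpace_re_lt _)).inter
    ((convex_halfSpace_im_gt _).inter (convex_halfSpace_im_lt _))

/-- The centre lies in its open box. [folklore] -/
theorem mem_box_self {b : ℂ} {s : ℝ} (hs : 0 < s) : b ∈ box b s :=
  mem_box.2 ⟨by linarith, by linarith, by linarith, by linarith⟩

/-- The closure of the open box is the closed box. [folklore] -/
theorem closure_box {b : ℂ} {s : ℝ} (hs : 0 < s) : closure (box b s) = closedBox b s := by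
  rw [box, closure_reProdIm, closure_Ioo (by linarith), closure_Ioo (by linarith)]; rfl

/-- The box of radius `s` lies in the ball of radius `2s`. [folklore] -/
theorem box_subset_ball {b : ℂ} {s : ℝ} : box b s ⊆ ball b (2 * s) := fun z hz => by
  rw [mem_box_iff_abs] at hz
  rw [mem_ball, dist_eq_norm]
  refine (norm_le_abs_re_add_abs_im _).trans_lt ?_
  rw [sub_re, sub_im]; linarith [hz.1, hz.2]

/-- The closed box of radius `s` lies in the closed ball of radius `2s`. [folklore] -/
theorem closedBox_subset_closedBall {b : ℂ} {s : ℝ} : closedBox b s ⊆ closedBall b (2 * s) := fun z hz => by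
  rw [mem_closedBox] at hz
  rw [mem_closedBall, dist_eq_norm]
  refine (norm_le_abs_re_add_abs_im _).trans ?_
  have h1 : |z.re - b.re| ≤ s := abs_le.2 ⟨by linarith [hz.1], by linarith [hz.2.1]⟩
  have h2 : |z.im - b.im| ≤ s := abs_le.2 ⟨by linarith [hz.2.2.1], by linarith [hz.2.2.2]⟩
  rw [sub_re, sub_im]; linarith

/-- The ball of radius `s` lies in the box of radius `s`. [folklore] -/
theorem ball_subset_box {b : ℂ} {s : ℝ} : ball b s ⊆ box b s := fun z hz => by
  rw [mem_ball, dist_eq_norm] at hz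
  rw [mem_box_iff_abs]
  exact ⟨(abs_re_le_norm (z - b)).trans_lt hz |> fun h => by rwa [sub_re] at h,
    (abs_im_le_norm (z - b)).trans_lt hz |> fun h => by rwa [sub_im] at h⟩

/-- Boxes are monotone in the radius. [folklore] -/
theorem box_mono {b : ℂ} {s s' : ℝ} (h : s ≤ s') : box b s ⊆ box b s' := fun z hz => by
  rw [mem_box] at hz ⊢; exact ⟨by linarith [hz.1], by linarith [hz.2.1], by linarith [hz.2.2.1], by linarith [hz.2.2.2]⟩

/-- Closed boxes are monotone in the radius. [folklore] -/
theorem closedBox_mono {b : ℂ} {s s' : ℝ} (h : s ≤ s') : closedBox b s ⊆ closedBox b s' := fun z hz => by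
  rw [mem_closedBox] at hz ⊢
  exact ⟨by linarith [hz.1], by linarith [hz.2.1], by linarith [hz.2.2.1], by linarith [hz.2.2.2]⟩

/-- A smaller closed box lies in a larger open box. [folklore] -/
theorem closedBox_subset_box {b : ℂ} {s s' : ℝ} (h : s < s') : closedBox b s ⊆ box b s' := fun z hz => by
  rw [mem_closedBox] at hz; rw [mem_box]
  exact ⟨by linarith [hz.1], by linarith [hz.2.1], by linarith [hz.2.2.1], by linarith [hz.2.2.2]⟩

/-- A box about a point of a box, of radius the margin, lies in the box. [folklore] -/
theorem box_subset_box_of_mem {b q : ℂ} {s ε : ℝ}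
    (hε : ε ≤ s - |q.re - b.re| ∧ ε ≤ s - |q.im - b.im|) : box q ε ⊆ box b s := fun z hz => by
  rw [mem_box_iff_abs] at hz ⊢
  constructor
  · calc |z.re - b.re| ≤ |z.re - q.re| + |q.re - b.re| := abs_sub_le _ _ _
      _ < s := by linarith [hz.1, hε.1]
  · calc |z.im - b.im| ≤ |z.im - q.im| + |q.im - b.im| := abs_sub_le _ _ _
      _ < s := by linarith [hz.2, hε.2]

/-- **The open box as a Jordan domain** (`Rectangles.rect`). [folklore] -/
def boxJD (b : ℂ) {s : ℝ} (hs : 0 < s) : JordanDomain :=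
  rect (show b.re - s < b.re + s by linarith) (show b.im - s < b.im + s by linarith)

/-- The carrier of the box domain is the open box. [folklore] -/
@[simp] theorem boxJD_carrier (b : ℂ) {s : ℝ} (hs : 0 < s) : (boxJD b hs).carrier = box b s := rfl

/-- The boundary loop of the box traces the square `closedBox ∖ box`. [folklore] -/
theorem range_boxJD_boundary (b : ℂ) {s : ℝ} (hs : 0 < s) :
    range (boxJD b hs).boundary = closedBox b s \ box b s := by
  rw [(boxJD b hs).range_boundary, boxJD_carrier, ← closure_box hs, frontier_eq_closure_inter_closure,
    (isOpen_box b s).isClosed_compl.closure_eq]; rfl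

/-- Points of the square are in the closed box and off the open box. [folklore] -/
theorem boundary_boxJD_mem (b : ℂ) {s : ℝ} (hs : 0 < s) (θ : ℝ) :
    (boxJD b hs).boundary θ ∈ closedBox b s ∧ (boxJD b hs).boundary θ ∉ box b s := by
  have := range_boxJD_boundary b hs ▸ mem_range_self (f := (boxJD b hs).boundary) θ
  exact this

/-! ### Local structure of the square: half-neighbourhoods -/

/-- An `L`-shaped union: a box cut by a vertical half-plane and by a horizontal half-plane gives
two convex pieces which, when both nonempty, share the point with the real part of a point of the
first and the imaginary part of a point of the second. [folklore] -/
theorem isPreconnected_box_inter_union {q : ℂ} {ε : ℝ} {Ph Pv : ℝ → Prop}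
    (hh : Convex ℝ {z : ℂ | Ph z.re}) (hv : Convex ℝ {z : ℂ | Pv z.im}) :
    IsPreconnected (box q ε ∩ {z | Ph z.re} ∪ box q ε ∩ {z | Pv z.im}) := by
  have hc1 : IsPreconnected (box q ε ∩ {z | Ph z.re}) := ((convex_box q ε).inter hh).isPreconnected
  have hc2 : IsPreconnected (box q ε ∩ {z | Pv z.im}) := ((convex_box q ε).inter hv).isPreconnected
  by_cases hne1 : (box q ε ∩ {z | Ph z.re}).Nonempty
  · by_cases hne2 : (box q ε ∩ {z | Pv z.im}).Nonempty
    · obtain ⟨z₁, hz₁, hh₁⟩ := hne1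
      obtain ⟨z₂, hz₂, hv₂⟩ := hne2
      rw [mem_box] at hz₁ hz₂
      have hw₁ : (⟨z₁.re, z₂.im⟩ : ℂ) ∈ box q ε ∩ {z | Ph z.re} :=
        ⟨mem_box.2 ⟨hz₁.1, hz₁.2.1, hz₂.2.2.1, hz₂.2.2.2⟩, hh₁⟩
      have hw₂ : (⟨z₁.re, z₂.im⟩ : ℂ) ∈ box q ε ∩ {z | Pv z.im} :=
        ⟨mem_box.2 ⟨hz₁.1, hz₁.2.1, hz₂.2.2.1, hz₂.2.2.2⟩, hv₂⟩
      exact hc1.union' ⟨_, hw₁, hw₂⟩ hc2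
    · rw [not_nonempty_iff_eq_empty.1 hne2, union_empty]; exact hc1
  · rw [not_nonempty_iff_eq_empty.1 hne1, empty_union]; exact hc2

/-- **The outer half-neighbourhood of a boundary point of a box is connected**: for `q` in the
closed box and `ε ≤ s`, the part of the small box `box q ε` outside the closed box is
preconnected (an `L`-shaped union of at most two rectangles sharing a corner region). [folklore] -/
theorem isPreconnected_box_diff_closedBox (b q : ℂ) {s ε : ℝ}
    (hε : ε ≤ s) : IsPreconnected (box q ε \ closedBox b s) := by
  -- the outer half-planes on the side of `q`
  rcases le_or_gt q.re b.re with hre | hre <;> rcases le_or_gt q.im b.im with him | him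
  · have key : box q ε \ closedBox b s =
        box q ε ∩ {z | z.re < b.re - s} ∪ box q ε ∩ {z | z.im < b.im - s} := by
      ext z
      rw [Set.mem_sdiff, mem_union, mem_inter_iff, mem_inter_iff, mem_setOf_eq, mem_setOf_eq, mem_closedBox]
      constructor
      · rintro ⟨hz, hzc⟩
        have hz' := mem_box.1 hz
        by_cases h1 : z.re < b.re - s
        · exact Or.inl ⟨hz, h1⟩
        · right; refine ⟨hz, ?_⟩
          by_contra h3
          exact hzc ⟨not_lt.1 h1, by linarith [hz'.2.1], not_lt.1 h3, by linarith [hz'.2.2.2]⟩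
      · rintro (⟨hz, h⟩ | ⟨hz, h⟩)
        · exact ⟨hz, fun hc => by linarith [hc.1]⟩
        · exact ⟨hz, fun hc => by linarith [hc.2.2.1]⟩
    rw [key]
    exact isPreconnected_box_inter_union (Ph := fun x => x < b.re - s) (Pv := fun y => y < b.im - s)
      (convex_halfSpace_re_lt _) (convex_halfSpace_im_lt _)
  · have key : box q ε \ closedBox b s =
        box q ε ∩ {z | z.re < b.re - s} ∪ box q ε ∩ {z | b.im + s < z.im} := by
      ext z
      rw [Set.mem_sdiff, mem_union, mem_inter_iff, mem_inter_iff, mem_setOf_eq, mem_setOf_eq, mem_closedBox]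
      constructor
      · rintro ⟨hz, hzc⟩
        have hz' := mem_box.1 hz
        by_cases h1 : z.re < b.re - s
        · exact Or.inl ⟨hz, h1⟩
        · right; refine ⟨hz, ?_⟩
          by_contra h3
          exact hzc ⟨not_lt.1 h1, by linarith [hz'.2.1], by linarith [hz'.2.2.1], not_lt.1 h3⟩
      · rintro (⟨hz, h⟩ | ⟨hz, h⟩)
        · exact ⟨hz, fun hc => by linarith [hc.1]⟩
        · exact ⟨hz, fun hc => by linarith [hc.2.2.2]⟩
    rw [key]
    exact isPreconnected_box_inter_union (Ph := fun x => x < b.re - s) (Pv := fun y => b.im + s < y)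
      (convex_halfSpace_re_lt _) (convex_halfSpace_im_gt _)
  · have key : box q ε \ closedBox b s =
        box q ε ∩ {z | b.re + s < z.re} ∪ box q ε ∩ {z | z.im < b.im - s} := by
      ext z
      rw [Set.mem_sdiff, mem_union, mem_inter_iff, mem_inter_iff, mem_setOf_eq, mem_setOf_eq, mem_closedBox]
      constructor
      · rintro ⟨hz, hzc⟩
        have hz' := mem_box.1 hz
        by_cases h1 : b.re + s < z.re
        · exact Or.inl ⟨hz, h1⟩
        · right; refine ⟨hz, ?_⟩
          by_contra h3
          exact hzc ⟨by linarith [hz'.1], not_lt.1 h1, not_lt.1 h3, by linarith [hz'.2.2.2]⟩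
      · rintro (⟨hz, h⟩ | ⟨hz, h⟩)
        · exact ⟨hz, fun hc => by linarith [hc.2.1]⟩
        · exact ⟨hz, fun hc => by linarith [hc.2.2.1]⟩
    rw [key]
    exact isPreconnected_box_inter_union (Ph := fun x => b.re + s < x) (Pv := fun y => y < b.im - s)
      (convex_halfSpace_re_gt _) (convex_halfSpace_im_lt _)
  · have key : box q ε \ closedBox b s =
        box q ε ∩ {z | b.re + s < z.re} ∪ box q ε ∩ {z | b.im + s < z.im} := by
      ext z
      rw [Set.mem_sdiff, mem_union, mem_inter_iff, mem_inter_iff, mem_setOf_eq, mem_setOf_eq, mem_closedBox]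
      constructor
      · rintro ⟨hz, hzc⟩
        have hz' := mem_box.1 hz
        by_cases h1 : b.re + s < z.re
        · exact Or.inl ⟨hz, h1⟩
        · right; refine ⟨hz, ?_⟩
          by_contra h3
          exact hzc ⟨by linarith [hz'.1], not_lt.1 h1, by linarith [hz'.2.2.1], not_lt.1 h3⟩
      · rintro (⟨hz, h⟩ | ⟨hz, h⟩)
        · exact ⟨hz, fun hc => by linarith [hc.2.1]⟩
        · exact ⟨hz, fun hc => by linarith [hc.2.2.2]⟩
    rw [key]
    exact isPreconnected_box_inter_union (Ph := fun x => b.re + s < x) (Pv := fun y => b.im + s < y)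
      (convex_halfSpace_re_gt _) (convex_halfSpace_im_gt _)

/-- The inner half-neighbourhood `box q ε ∩ box b s` is convex, hence preconnected. [folklore] -/
theorem isPreconnected_box_inter_box (b q : ℂ) (s ε : ℝ) : IsPreconnected (box q ε ∩ box b s) :=
  ((convex_box q ε).inter (convex_box b s)).isPreconnected

/-- Points of the square are limits of points of the open box inside any open neighbourhood.
[folklore] -/
theorem mem_closure_inter_box {b q : ℂ} {s : ℝ} (hs : 0 < s) (hq : q ∈ closedBox b s) {N : Set ℂ}
    (hN : IsOpen N) (hqN : q ∈ N) : q ∈ closure (N ∩ box b s) := by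
  rw [← closure_box hs] at hq
  rw [inter_comm]
  exact mem_closure_iff_nhds.2 fun t ht => by
    have := mem_closure_iff_nhds.1 hq (t ∩ N) (inter_mem ht (hN.mem_nhds hqN))
    obtain ⟨z, ⟨hzt, hzN⟩, hzb⟩ := this
    exact ⟨z, hzt, hzb, hzN⟩

/-! ### More on gates of a general loop: periodicity and canonicity of the gate set -/

section GateSets
variable {D Q : JordanDomain} (h2 : TwoOff D Q)
include h2

omit h2 in
/-- Equal loop points have parameters differing by an integer. [folklore] -/
theorem _root_.Literature.Probability.RandomPlanarGeometry.JordanDomain.exists_int_eq_add_of_boundary_eq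
    (Q : JordanDomain) {θ₁ θ₂ : ℝ} (h : Q.boundary θ₁ = Q.boundary θ₂) : ∃ k : ℤ, θ₂ = θ₁ + k := by
  -- representative of `θ₂` in `[θ₁, θ₁ + 1)`
  set θ' : ℝ := θ₂ - ⌊θ₂ - θ₁⌋ with hθ'
  have h1 := Int.floor_le (θ₂ - θ₁)
  have h1' := Int.lt_floor_add_one (θ₂ - θ₁)
  have hmem : θ' ∈ Ico θ₁ (θ₁ + 1) := ⟨by rw [hθ']; linarith, by rw [hθ']; linarith⟩
  have heq : Q.boundary θ' = Q.boundary θ₂ := by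
    rw [hθ', show θ₂ - (⌊θ₂ - θ₁⌋ : ℝ) = θ₂ - ((⌊θ₂ - θ₁⌋ : ℤ) : ℝ) * 1 by ring]
    exact Q.periodic_boundary.sub_int_mul_eq _
  have := Q.injOn_boundary_Ico θ₁ ⟨le_rfl, by linarith⟩ hmem (by rw [heq, h])
  exact ⟨⌊θ₂ - θ₁⌋, by rw [hθ'] at this; linarith⟩

/-- The gate set is `1`-periodic in the parameter. [folklore] -/
theorem gate_add_int (t₀ : ℝ) (k : ℤ) : gate D Q (t₀ + k) = gate D Q t₀ := by
  rw [gate, gate, gateLo_add_int h2, gateHi_add_int h2, ← image_add_const_Ioo, ← image_comp]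
  refine image_congr fun θ _ => ?_
  show Q.boundary (θ + k) = Q.boundary θ
  rw [show θ + (k : ℝ) = θ + (k : ℤ) * (1 : ℝ) by ring]
  exact (Q.periodic_boundary.int_mul k) θ

/-- **Canonicity of the gate set**: a parameter of the gate interval defines the same gate. [folklore] -/
theorem gate_eq_of_mem_Ioo {t₀ θ : ℝ} (hθ : θ ∈ Ioo (gateLo D Q t₀) (gateHi D Q t₀)) : gate D Q θ = gate D Q t₀ := by
  rw [gate, gate, gateLo_eq_of_mem h2 hθ, gateHi_eq_of_mem h2 hθ]

/-- **Gates are equal or disjoint.** [folklore] -/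
theorem gate_eq_of_not_disjoint {t₁ t₂ : ℝ} (h : ¬ Disjoint (gate D Q t₁) (gate D Q t₂)) :
    gate D Q t₁ = gate D Q t₂ := by
  obtain ⟨z, ⟨θ₁, hθ₁, rfl⟩, ⟨θ₂, hθ₂, he⟩⟩ := not_disjoint_iff.1 h
  obtain ⟨k, hk⟩ := Q.exists_int_eq_add_of_boundary_eq he.symm
  -- `θ₁ = θ₂ + k`
  rw [← gate_eq_of_mem_Ioo h2 hθ₁, ← gate_eq_of_mem_Ioo h2 hθ₂, hk, gate_add_int h2]

omit h2 in
/-- A gate is preconnected. [folklore] -/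
theorem isPreconnected_gate (t₀ : ℝ) : IsPreconnected (gate D Q t₀) :=
  isPreconnected_Ioo.image _ Q.continuous_boundary.continuousOn

/-- A gate through a parameter mapped into `D` is nonempty. [folklore] -/
theorem gate_nonempty {t₀ : ℝ} (ht₀ : t₀ ∈ gateParams D Q) : (gate D Q t₀).Nonempty :=
  ⟨_, boundary_mem_gate h2 ht₀⟩

end GateSets

/-! ### Two points of the square off `D` -/

/-- **A box about a boundary point, not containing the whole boundary, has two points of its
square off `D`**: the two arcs of `∂D` from `b` (inside) to a boundary point outside the closed
box cross the square at distinct boundary points of `D`. [folklore] -/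
theorem twoOff_boxJD (D : JordanDomain) {b : ℂ} {s : ℝ} (hs : 0 < s) (hb : b ∈ frontier D.carrier)
    (hout : ¬ frontier D.carrier ⊆ closedBox b s) : TwoOff D (boxJD b hs) := by
  obtain ⟨p, hp, hpc⟩ := not_subset.1 hout
  have hbp : b ≠ p := fun h => hpc (h ▸ box_subset_closedBox b s (mem_box_self hs))
  obtain ⟨σ, τ, hστ, hτσ, hσ, hτ⟩ := D.exists_params_of_ne hb hp hbp
  -- each of the two arcs meets the square `closedBox \ box`
  have cross : ∀ u v : ℝ, u ≤ v → D.boundary u ∈ box b s → D.boundary v ∉ closedBox b s →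
      ∃ θ ∈ Ioo u v, D.boundary θ ∈ closedBox b s \ box b s := by
    intro u v huv hu hv
    set A : Set ℂ := D.boundary '' Icc u v
    have hA : IsPreconnected A := isPreconnected_Icc.image _ D.continuous_boundary.continuousOn
    by_contra hcon
    push Not at hcon
    have hcover : A ⊆ box b s ∪ (closedBox b s)ᶜ := by
      rintro _ ⟨θ, hθ, rfl⟩
      by_cases h1 : D.boundary θ ∈ box b s
      · exact Or.inl h1
      by_cases h2 : D.boundary θ ∈ closedBox b s
      · exfalso
        rcases eq_or_lt_of_le hθ.1 with h | h
        · exact h1 (h ▸ hu)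
        rcases eq_or_lt_of_le hθ.2 with h' | h'
        · exact hv (h' ▸ h2)
        exact hcon θ ⟨h, h'⟩ ⟨h2, h1⟩
      · exact Or.inr h2
    have hdisj : Disjoint (box b s) (closedBox b s)ᶜ :=
      disjoint_compl_right.mono_left (box_subset_closedBox b s)
    rcases hA.subset_or_subset (isOpen_box b s) (isClosed_closedBox b s).isOpen_compl hdisj hcover with h | h
    · exact hv (box_subset_closedBox b s (h ⟨v, right_mem_Icc.2 huv, rfl⟩))
    · exact h ⟨u, left_mem_Icc.2 huv, rfl⟩ (box_subset_closedBox b s hu)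
  have hbσ : D.boundary σ ∈ box b s := by rw [hσ]; exact mem_box_self hs
  have hbσ1 : D.boundary (σ + 1) ∈ box b s := by rw [D.periodic_boundary σ, hσ]; exact mem_box_self hs
  have hpτ : D.boundary τ ∉ closedBox b s := by rw [hτ]; exact hpc
  obtain ⟨θ₁, hθ₁, hz₁⟩ := cross σ τ hστ.le hbσ hpτ
  -- second arc, run backwards: from `σ + 1` down to `τ`; use the arc `[τ, σ + 1]` with roles swapped
  have cross' : ∃ θ ∈ Ioo τ (σ + 1), D.boundary θ ∈ closedBox b s \ box b s := by
    set A : Set ℂ := D.boundary '' Icc τ (σ + 1)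
    have hA : IsPreconnected A := isPreconnected_Icc.image _ D.continuous_boundary.continuousOn
    by_contra hcon
    push Not at hcon
    have hcover : A ⊆ box b s ∪ (closedBox b s)ᶜ := by
      rintro _ ⟨θ, hθ, rfl⟩
      by_cases h1 : D.boundary θ ∈ box b s
      · exact Or.inl h1
      by_cases h2 : D.boundary θ ∈ closedBox b s
      · exfalso
        rcases eq_or_lt_of_le hθ.1 with h | h
        · exact hpτ (h ▸ h2)
        rcases eq_or_lt_of_le hθ.2 with h' | h'
        · exact h1 (h' ▸ hbσ1)
        exact hcon θ ⟨h, h'⟩ ⟨h2, h1⟩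
      · exact Or.inr h2
    have hdisj : Disjoint (box b s) (closedBox b s)ᶜ :=
      disjoint_compl_right.mono_left (box_subset_closedBox b s)
    rcases hA.subset_or_subset (isOpen_box b s) (isClosed_closedBox b s).isOpen_compl hdisj hcover with h | h
    · exact hpτ (box_subset_closedBox b s (h ⟨τ, left_mem_Icc.2 hτσ.le, rfl⟩))
    · exact h ⟨σ + 1, right_mem_Icc.2 hτσ.le, rfl⟩ (box_subset_closedBox b s hbσ1)
  obtain ⟨θ₂, hθ₂, hz₂⟩ := cross'
  -- the two crossing points are distinct boundary points of `D` on the square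
  have hne : D.boundary θ₁ ≠ D.boundary θ₂ := fun h => by
    have := D.injOn_boundary_Ico σ ⟨hθ₁.1.le, by linarith [hθ₁.2]⟩ ⟨by linarith [hθ₂.1], hθ₂.2⟩ h
    linarith [hθ₁.2, hθ₂.1]
  have hoff : ∀ θ, D.boundary θ ∉ D.carrier := fun θ h => by
    have hmem : D.boundary θ ∈ D.carrier ∩ frontier D.carrier := ⟨h, D.boundary_mem_frontier θ⟩
    rw [D.isOpen.inter_frontier_eq] at hmem
    exact hmem
  have hr₁ : D.boundary θ₁ ∈ range (boxJD b hs).boundary := by rw [range_boxJD_boundary]; exact hz₁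
  have hr₂ : D.boundary θ₂ ∈ range (boxJD b hs).boundary := by rw [range_boxJD_boundary]; exact hz₂
  obtain ⟨φ₁, hφ₁⟩ := hr₁
  obtain ⟨φ₂, hφ₂⟩ := hr₂
  exact ⟨φ₁, φ₂, hφ₁ ▸ hoff θ₁, hφ₂ ▸ hoff θ₂, by rw [hφ₁, hφ₂]; exact hne⟩

/-! ### The germ chamber and its gates -/

section Chamber

variable (D : JordanDomain) (b : ℂ) (s : ℝ)

/-- The **chamber** of `g` in the box: the connected component of `g` in `D ∩ box b s`. [folklore] -/
def chamber (g : ℂ) : Set ℂ := connectedComponentIn (D.carrier ∩ box b s) g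

variable {D b s}

/-- The chamber lies in `D ∩ box`. [folklore] -/
theorem chamber_subset (g : ℂ) : chamber D b s g ⊆ D.carrier ∩ box b s := connectedComponentIn_subset _ _

/-- Chambers are open. [folklore] -/
theorem isOpen_chamber (g : ℂ) : IsOpen (chamber D b s g) := (D.isOpen.inter (isOpen_box b s)).connectedComponentIn

/-- Chambers are preconnected. [folklore] -/
theorem isPreconnected_chamber (g : ℂ) : IsPreconnected (chamber D b s g) := isPreconnected_connectedComponentIn

/-- The base point lies in its chamber. [folklore] -/
theorem mem_chamber {g : ℂ} (hg : g ∈ D.carrier ∩ box b s) : g ∈ chamber D b s g := mem_connectedComponentIn hg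

/-- A preconnected subset of `D ∩ box` meeting the chamber lies in it. [folklore] -/
theorem subset_chamber_of_isPreconnected {g : ℂ} {S : Set ℂ} (hS : IsPreconnected S)
    (hSD : S ⊆ D.carrier ∩ box b s) (hmeet : (S ∩ chamber D b s g).Nonempty) : S ⊆ chamber D b s g := by
  obtain ⟨z, hzS, hz⟩ := hmeet
  rw [chamber] at hz ⊢
  rw [connectedComponentIn_eq hz]
  exact hS.subset_connectedComponentIn hzS hSD

/-- **Inner half-neighbourhoods at frontier points lie in the chamber**: if `q ∈ frontier G` and
the small box `box q ε ⊆ D`, then `box q ε ∩ box b s ⊆ G`. [folklore] -/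
theorem box_inter_box_subset_chamber {g q : ℂ} (hq : q ∈ frontier (chamber D b s g)) {ε : ℝ} (hε : 0 < ε)
    (hN : box q ε ⊆ D.carrier) : box q ε ∩ box b s ⊆ chamber D b s g := by
  have hqc : q ∈ closure (chamber D b s g) := frontier_subset_closure hq
  obtain ⟨w, hwN, hwG⟩ := mem_closure_iff_nhds.1 hqc (box q ε) ((isOpen_box q ε).mem_nhds (mem_box_self hε))
  exact subset_chamber_of_isPreconnected (isPreconnected_box_inter_box b q s ε)
    (fun z hz => ⟨hN hz.1, hz.2⟩) ⟨w, ⟨hwN, (chamber_subset g hwG).2⟩, hwG⟩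

/-- A point of the closure of the chamber inside the open box lies in the chamber. [folklore] -/
theorem mem_chamber_of_mem_closure {g z : ℂ} (hz : z ∈ closure (chamber D b s g)) (hzD : z ∈ D.carrier)
    (hzb : z ∈ box b s) : z ∈ chamber D b s g := by
  -- a small box about `z` inside `D ∩ box b s`
  obtain ⟨r, hr, hrD⟩ := Metric.isOpen_iff.1 (D.isOpen.inter (isOpen_box b s)) z ⟨hzD, hzb⟩
  have hsub : box z (r / 2) ⊆ D.carrier ∩ box b s :=
    (box_subset_ball.trans (by rw [show 2 * (r / 2) = r by ring])) |>.trans hrD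
  obtain ⟨w, hwN, hwG⟩ := mem_closure_iff_nhds.1 hz (box z (r / 2)) ((isOpen_box z _).mem_nhds (mem_box_self (by positivity)))
  exact subset_chamber_of_isPreconnected (convex_box z _).isPreconnected hsub ⟨w, hwN, hwG⟩ (mem_box_self (by positivity))

end Chamber

/-! ### Gates of the germ chamber -/

section GatesOfChamber

variable {D : JordanDomain} {b : ℂ} {s : ℝ} (hs : 0 < s) (h2 : TwoOff D (boxJD b hs))

/-- The gate through `t₀` is a **gate of the chamber** of `g`: it meets the frontier of the chamber.
[folklore] -/
def IsGateOf (D : JordanDomain) (b : ℂ) {s : ℝ} (hs : 0 < s) (g : ℂ) (t₀ : ℝ) : Prop :=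
  (gate D (boxJD b hs) t₀ ∩ frontier (chamber D b s g)).Nonempty

include h2

/-- **Square points near a gate point lie in the gate**: a point of `D` on the square has a small
box neighbourhood inside `D`, of radius `≤ s`, whose points on the square all belong to the gate.
[folklore] -/
theorem exists_box_inter_range_subset_gate {t₀ : ℝ} (ht₀ : t₀ ∈ gateParams D (boxJD b hs)) :
    ∃ ε > 0, ε ≤ s ∧ box ((boxJD b hs).boundary t₀) ε ⊆ D.carrier ∧
      box ((boxJD b hs).boundary t₀) ε ∩ range (boxJD b hs).boundary ⊆ gate D (boxJD b hs) t₀ := by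
  set Q := boxJD b hs
  set q := Q.boundary t₀
  have hlo := gateLo_lt h2 ht₀
  have hhi := lt_gateHi h2 ht₀
  set τ : ℝ := min (min (t₀ - gateLo D Q t₀) (gateHi D Q t₀ - t₀)) (1 / 2) with hτ
  have hτ0 : 0 < τ := lt_min (lt_min (by linarith) (by linarith)) (by norm_num)
  obtain ⟨m, hm, hsep⟩ := Q.exists_int_abs_sub_lt_of_dist_lt hτ0 (min_le_right _ _)
  obtain ⟨r, hr, hrD⟩ := Metric.isOpen_iff.1 D.isOpen q ht₀
  refine ⟨min (min (r / 2) (m / 4)) s, lt_min (lt_min (by positivity) (by positivity)) hs, min_le_right _ _, ?_, ?_⟩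
  · refine (box_subset_ball.trans (ball_subset_ball ?_)).trans hrD
    linarith [min_le_left (min (r / 2) (m / 4)) s, min_le_left (r / 2) (m / 4)]
  · rintro z ⟨hz, θ, rfl⟩
    have hd : dist (Q.boundary t₀) (Q.boundary θ) < m := by
      have h1 : Q.boundary θ ∈ ball q (2 * min (min (r / 2) (m / 4)) s) := box_subset_ball hz
      rw [mem_ball, dist_comm] at h1
      refine h1.trans_le ?_
      linarith [min_le_left (min (r / 2) (m / 4)) s, min_le_right (r / 2) (m / 4)]
    obtain ⟨k, hk⟩ := hsep t₀ θ hd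
    have hθ' : θ - k ∈ Ioo (gateLo D Q t₀) (gateHi D Q t₀) := by
      rw [abs_lt] at hk
      have h1 : τ ≤ t₀ - gateLo D Q t₀ := (min_le_left _ _).trans (min_le_left _ _)
      have h2' : τ ≤ gateHi D Q t₀ - t₀ := (min_le_left _ _).trans (min_le_right _ _)
      constructor <;> linarith [hk.1, hk.2]
    have heq : Q.boundary (θ - k) = Q.boundary θ := by
      rw [show θ - (k : ℝ) = θ - (k : ℤ) * (1 : ℝ) by ring]; exact Q.periodic_boundary.sub_int_mul_eq k
    exact ⟨θ - k, hθ', heq⟩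

omit h2 in
/-- **A gate meeting the frontier of a chamber lies entirely in that frontier.** [folklore] -/
theorem gate_subset_frontier_chamber {g : ℂ} {t₀ : ℝ}
    (hG : IsGateOf D b hs g t₀) : gate D (boxJD b hs) t₀ ⊆ frontier (chamber D b s g) := by
  set Q := boxJD b hs
  set G := chamber D b s g
  -- `P` = parameters mapped to the frontier; `V` = parameters with a good neighbourhood
  set P : Set ℝ := {θ | Q.boundary θ ∈ frontier G} with hP
  set V : Set ℝ := {θ | ∃ N : Set ℂ, IsOpen N ∧ N ⊆ D.carrier ∧ N ∩ box b s ⊆ G ∧ Q.boundary θ ∈ N} with hV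
  have hPc : IsClosed P := isClosed_frontier.preimage Q.continuous_boundary
  have hVo : IsOpen V := by
    refine isOpen_iff_mem_nhds.2 fun θ ⟨N, hNo, hND, hNG, hθN⟩ => ?_
    exact mem_of_superset ((hNo.preimage Q.continuous_boundary).mem_nhds hθN)
      fun θ' hθ' => ⟨N, hNo, hND, hNG, hθ'⟩
  have hVP : V ⊆ P := by
    rintro θ ⟨N, hNo, -, hNG, hθN⟩
    have hsq := boundary_boxJD_mem b hs θ
    refine ⟨closure_mono hNG (mem_closure_inter_box hs hsq.1 hNo hθN), ?_⟩
    rw [(isOpen_chamber g).interior_eq]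
    exact fun h => hsq.2 (chamber_subset g h).2
  have hPV : ∀ θ ∈ P, θ ∈ gateParams D Q → θ ∈ V := by
    intro θ hθP hθD
    obtain ⟨r, hr, hrD⟩ := Metric.isOpen_iff.1 D.isOpen _ hθD
    refine ⟨box (Q.boundary θ) (r / 2), isOpen_box _ _, box_subset_ball.trans (by rw [show 2 * (r / 2) = r by ring]; exact hrD), ?_, mem_box_self (by positivity)⟩
    exact box_inter_box_subset_chamber hθP (by positivity) (box_subset_ball.trans (by rw [show 2 * (r / 2) = r by ring]; exact hrD))
  -- connectedness of the gate interval
  obtain ⟨_, ⟨θ₁, hθ₁, rfl⟩, hθ₁P⟩ := hG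
  have hcover : Ioo (gateLo D Q t₀) (gateHi D Q t₀) ⊆ V ∪ Pᶜ := fun θ hθ => by
    by_cases h : θ ∈ P
    · exact Or.inl (hPV θ h (mem_of_mem_Ioo_gate hθ))
    · exact Or.inr h
  have hdisj : Disjoint V Pᶜ := disjoint_compl_right.mono_left hVP
  rcases isPreconnected_Ioo.subset_or_subset hVo hPc.isOpen_compl hdisj hcover with h | h
  · rintro _ ⟨θ, hθ, rfl⟩; exact hVP (h hθ)
  · exact absurd hθ₁P (h hθ₁)

/-- **The closure of the chamber inside `D`**: a point of `D` in the closure of the chamber is in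
the chamber or on one of its gates. [folklore] -/
theorem mem_gate_of_mem_closure_chamber {g z : ℂ} (hz : z ∈ closure (chamber D b s g)) (hzD : z ∈ D.carrier)
    (hzG : z ∉ chamber D b s g) :
    ∃ t₀ ∈ gateParams D (boxJD b hs), IsGateOf D b hs g t₀ ∧ z ∈ gate D (boxJD b hs) t₀ := by
  have hzc : z ∈ closedBox b s := by
    rw [← closure_box hs]; exact closure_mono (fun w hw => (chamber_subset g hw).2) hz
  have hzb : z ∉ box b s := fun h => hzG (mem_chamber_of_mem_closure hz hzD h)
  have hzr : z ∈ range (boxJD b hs).boundary := by rw [range_boxJD_boundary]; exact ⟨hzc, hzb⟩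
  obtain ⟨t₀, rfl⟩ := hzr
  have hfr : (boxJD b hs).boundary t₀ ∈ frontier (chamber D b s g) :=
    ⟨hz, by rw [(isOpen_chamber g).interior_eq]; exact hzG⟩
  exact ⟨t₀, hzD, ⟨_, boundary_mem_gate h2 hzD, hfr⟩, boundary_mem_gate h2 hzD⟩

omit h2 in
/-- The base point (in the open box) is off every gate. [folklore] -/
theorem base_not_mem_gate {g : ℂ} (hg : g ∈ D.carrier ∩ box b s) (t₀ : ℝ) :
    g ∈ D.carrier \ gate D (boxJD b hs) t₀ :=
  ⟨hg.1, fun ⟨θ, _, hθ⟩ => (boundary_boxJD_mem b hs θ).2 (hθ ▸ hg.2)⟩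

omit h2 in
/-- The chamber misses every gate (it lies in the open box). [folklore] -/
theorem chamber_subset_diff_gate (g : ℂ) (t₀ : ℝ) : chamber D b s g ⊆ D.carrier \ gate D (boxJD b hs) t₀ :=
  fun _ hz => ⟨(chamber_subset g hz).1, fun ⟨θ, _, hθ⟩ => (boundary_boxJD_mem b hs θ).2 (hθ ▸ (chamber_subset g hz).2)⟩

omit h2 in
/-- The chamber lies on the near side (the side of `g`) of each of its gates. [folklore] -/
theorem chamber_subset_gateSide {g : ℂ} (hg : g ∈ D.carrier ∩ box b s) (t₀ : ℝ) :
    chamber D b s g ⊆ gateSide D (boxJD b hs) g t₀ :=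
  subset_gateSide_of_isPreconnected (isPreconnected_chamber g) (chamber_subset_diff_gate hs g t₀)
    ⟨g, mem_chamber hg, mem_gateSide (base_not_mem_gate hs hg t₀)⟩

/-- **Outer half-neighbourhoods at a gate of the chamber lie in the far side.** [folklore] -/
theorem box_diff_closedBox_subset_gateFar {g : ℂ} (hg : g ∈ D.carrier ∩ box b s) {t₀ : ℝ}
    (ht₀ : t₀ ∈ gateParams D (boxJD b hs)) (hG : IsGateOf D b hs g t₀) {θ : ℝ}
    (hθ : θ ∈ Ioo (gateLo D (boxJD b hs) t₀) (gateHi D (boxJD b hs) t₀)) {ε : ℝ} (hε : 0 < ε) (hεs : ε ≤ s)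
    (hND : box ((boxJD b hs).boundary θ) ε ⊆ D.carrier)
    (hNg : box ((boxJD b hs).boundary θ) ε ∩ range (boxJD b hs).boundary ⊆ gate D (boxJD b hs) t₀) :
    box ((boxJD b hs).boundary θ) ε \ closedBox b s ⊆ gateFar D (boxJD b hs) g t₀ := by
  set Q := boxJD b hs
  set q := Q.boundary θ
  set O := box q ε \ closedBox b s
  have hO : IsPreconnected O := isPreconnected_box_diff_closedBox b q hεs
  have hq : q ∈ gate D Q t₀ := ⟨θ, hθ, rfl⟩
  have hgq := base_not_mem_gate hs hg t₀
  have hspec := gateSide_gateFar_spec h2 ht₀ hgq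
  have hOD : O ⊆ D.carrier \ gate D Q t₀ := fun z hz =>
    ⟨hND hz.1, fun ⟨φ, _, hφ⟩ => hz.2 (hφ ▸ (boundary_boxJD_mem b hs φ).1)⟩
  have hcover : O ⊆ gateSide D Q g t₀ ∪ gateFar D Q g t₀ := by rw [gateSide_union_gateFar]; exact hOD
  -- the far side meets `O`
  obtain ⟨w, hwN, hwF⟩ := mem_closure_iff_nhds.1 (gate_subset_closure_gateFar h2 ht₀ hgq hq) (box q ε)
    ((isOpen_box q ε).mem_nhds (mem_box_self hε))
  have hwO : w ∈ O := by
    refine ⟨hwN, fun hwc => ?_⟩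
    by_cases hwb : w ∈ box b s
    · -- then `w ∈ G ⊆ gateSide`, contradicting `w ∈ gateFar`
      have hwG : w ∈ chamber D b s g := box_inter_box_subset_chamber
        (gate_subset_frontier_chamber hs hG hq) hε hND ⟨hwN, hwb⟩
      exact Set.disjoint_left.1 (disjoint_gateSide_gateFar g t₀) (chamber_subset_gateSide hs hg t₀ hwG) hwF
    · -- then `w` is on the square, hence in the gate, contradicting `w ∈ gateFar ⊆ D ∖ gate`
      have hwr : w ∈ range Q.boundary := by rw [range_boxJD_boundary]; exact ⟨hwc, hwb⟩
      exact (gateFar_subset g t₀ hwF).2 (hNg ⟨hwN, hwr⟩)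
  rcases hO.subset_or_subset hspec.1 hspec.2.1 (disjoint_gateSide_gateFar g t₀) hcover with h | h
  · exact absurd hwF (Set.disjoint_left.1 (disjoint_gateSide_gateFar g t₀) (h hwO))
  · exact h

end GatesOfChamber

/-! ### The chamber decomposition of `D` -/

section Decomposition

variable {D : JordanDomain} {b : ℂ} {s : ℝ} (hs : 0 < s) (h2 : TwoOff D (boxJD b hs))
include h2

/-- **Chamber decomposition**: a point of `D` outside the germ chamber and off its gates lies in
the far side of some gate of the chamber (follow a path to the base point up to its first
entrance into the closure of the chamber; just before, it is in the outer half-neighbourhood of a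
gate point). [folklore] -/
theorem mem_gateFar_of_not_mem {g : ℂ} (hg : g ∈ D.carrier ∩ box b s) {z : ℂ} (hz : z ∈ D.carrier)
    (hzG : z ∉ chamber D b s g)
    (hzg : ∀ t₀ ∈ gateParams D (boxJD b hs), IsGateOf D b hs g t₀ → z ∉ gate D (boxJD b hs) t₀) :
    ∃ t₀ ∈ gateParams D (boxJD b hs), IsGateOf D b hs g t₀ ∧ z ∈ gateFar D (boxJD b hs) g t₀ := by
  set Q := boxJD b hs
  set G := chamber D b s g
  have hpc : IsPathConnected D.carrier := D.isOpen.isConnected_iff_isPathConnected.1 D.isConnected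
  obtain ⟨γ, hγ⟩ := hpc.joinedIn z hz g hg.1
  -- parameters whose image is in the closure of the chamber
  set T : Set ℝ := {t | t ∈ Icc (0 : ℝ) 1 ∧ γ.extend t ∈ closure G} with hT
  have hTc : IsClosed T := isClosed_Icc.inter (isClosed_closure.preimage γ.extend.continuous)
  have hT1 : (1 : ℝ) ∈ T := ⟨right_mem_Icc.2 zero_le_one, by
    rw [γ.extend_one]; exact subset_closure (mem_chamber hg)⟩
  have hTbdd : BddBelow T := ⟨0, fun t ht => ht.1.1⟩
  set t₀ := sInf T with ht₀def
  have ht₀ : t₀ ∈ T := hTc.csInf_mem ⟨1, hT1⟩ hTbdd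
  have hbefore : ∀ t ∈ Ico (0 : ℝ) t₀, γ.extend t ∉ closure G := fun t ht hc =>
    (csInf_le hTbdd ⟨⟨ht.1, ht.2.le.trans ht₀.1.2⟩, hc⟩).not_gt ht.2
  have hγD : ∀ t : ℝ, γ.extend t ∈ D.carrier := fun t => by
    rw [Path.extend, ContinuousMap.coe_mk]  -- fall back: use `IccExtend`
    exact hγ _
  set q := γ.extend t₀ with hq
  have hqD : q ∈ D.carrier := hγD t₀
  -- a parameter slightly before `t₀` mapped into a given open neighbourhood of `q`
  have near : ∀ N : Set ℂ, IsOpen N → q ∈ N → 0 < t₀ → ∃ t ∈ Ico (0 : ℝ) t₀, γ.extend t ∈ N := by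
    intro N hN hqN ht₀pos
    obtain ⟨η, hη, hηN⟩ := Metric.isOpen_iff.1 (hN.preimage γ.extend.continuous) t₀ hqN
    refine ⟨t₀ - min (η / 2) (t₀ / 2), ⟨?_, ?_⟩, hηN ?_⟩
    · have := min_le_right (η / 2) (t₀ / 2); linarith [ht₀.1.1]
    · have : 0 < min (η / 2) (t₀ / 2) := lt_min (by positivity) (by positivity); linarith
    · rw [mem_ball, Real.dist_eq, show t₀ - min (η / 2) (t₀ / 2) - t₀ = -min (η / 2) (t₀ / 2) by ring, abs_neg,
        abs_of_pos (lt_min (by positivity) (by positivity))]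
      linarith [min_le_left (η / 2) (t₀ / 2)]
  by_cases hqG : q ∈ G
  · -- then `t₀ = 0` (else an earlier parameter is already in `G`), so `z = q ∈ G`: excluded
    exfalso
    rcases eq_or_lt_of_le ht₀.1.1 with h0 | h0
    · apply hzG; rw [← γ.extend_zero, h0]; exact hqG
    · obtain ⟨t, ht, htG⟩ := near G (isOpen_chamber g) hqG h0
      exact hbefore t ht (subset_closure htG)
  · obtain ⟨t₁, ht₁, hG₁, hq₁⟩ := mem_gate_of_mem_closure_chamber hs h2 ht₀.2 hqD hqG
    refine ⟨t₁, ht₁, hG₁, ?_⟩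
    rcases eq_or_lt_of_le ht₀.1.1 with h0 | h0
    · exfalso; apply hzg t₁ ht₁ hG₁; rw [← γ.extend_zero, h0]; exact hq₁
    obtain ⟨θ, hθ, hθq⟩ := hq₁
    have hθD : θ ∈ gateParams D Q := by show Q.boundary θ ∈ D.carrier; rw [hθq]; exact hqD
    obtain ⟨ε, hε, hεs, hND, hNg⟩ := exists_box_inter_range_subset_gate hs h2 hθD
    rw [gate_eq_of_mem_Ioo h2 hθ] at hNg
    rw [hθq] at hND hNg
    have hfar : box q ε \ closedBox b s ⊆ gateFar D Q g t₁ := by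
      have := box_diff_closedBox_subset_gateFar hs h2 hg ht₁ hG₁ hθ hε hεs (by rw [hθq]; exact hND)
        (by rw [hθq]; exact hNg)
      rwa [hθq] at this
    obtain ⟨t, ht, htN⟩ := near (box q ε) (isOpen_box q ε) (mem_box_self hε) h0
    have hqfr : q ∈ frontier G := gate_subset_frontier_chamber hs hG₁ ⟨θ, hθ, hθq⟩
    -- `γ.extend t` is in the outer half-neighbourhood
    have hw : γ.extend t ∈ box q ε \ closedBox b s := by
      refine ⟨htN, fun hwc => ?_⟩
      by_cases hwb : γ.extend t ∈ box b s
      · exact hbefore t ht (subset_closure (box_inter_box_subset_chamber hqfr hε hND ⟨htN, hwb⟩))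
      · have hwr : γ.extend t ∈ range Q.boundary := by rw [range_boxJD_boundary]; exact ⟨hwc, hwb⟩
        exact hbefore t ht (frontier_subset_closure (gate_subset_frontier_chamber hs hG₁ (hNg ⟨htN, hwr⟩)))
    -- the initial segment of the path is connected, off the gate, and meets the far side
    set A : Set ℂ := γ.extend '' Icc 0 t
    have hA : IsPreconnected A := isPreconnected_Icc.image _ γ.extend.continuous.continuousOn
    have hgq := base_not_mem_gate hs hg t₁
    have hspec := gateSide_gateFar_spec h2 ht₁ hgq
    have hAD : A ⊆ D.carrier \ gate D Q t₁ := by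
      rintro _ ⟨u, hu, rfl⟩
      refine ⟨hγD u, fun h => hbefore u ⟨hu.1, hu.2.trans_lt ht.2⟩ ?_⟩
      exact frontier_subset_closure (gate_subset_frontier_chamber hs hG₁ h)
    have hcover : A ⊆ gateSide D Q g t₁ ∪ gateFar D Q g t₁ := by rw [gateSide_union_gateFar]; exact hAD
    rcases hA.subset_or_subset hspec.1 hspec.2.1 (disjoint_gateSide_gateFar g t₁) hcover with h | h
    · exact absurd (hfar hw) (Set.disjoint_left.1 (disjoint_gateSide_gateFar g t₁) (h ⟨t, right_mem_Icc.2 ht.1, rfl⟩))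
    · have : z = γ.extend 0 := γ.extend_zero.symm
      rw [this]; exact h ⟨0, left_mem_Icc.2 ht.1, rfl⟩

/-- **Far sides of distinct gates of the chamber are disjoint.** [folklore] -/
theorem disjoint_gateFar_of_ne {g : ℂ} (hg : g ∈ D.carrier ∩ box b s) {t₁ t₂ : ℝ}
    (ht₁ : t₁ ∈ gateParams D (boxJD b hs)) (ht₂ : t₂ ∈ gateParams D (boxJD b hs))
    (hG₁ : IsGateOf D b hs g t₁) (hG₂ : IsGateOf D b hs g t₂) (hne : gate D (boxJD b hs) t₁ ≠ gate D (boxJD b hs) t₂) :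
    Disjoint (gateFar D (boxJD b hs) g t₁) (gateFar D (boxJD b hs) g t₂) := by
  set Q := boxJD b hs
  set G := chamber D b s g
  have hd : Disjoint (gate D Q t₁) (gate D Q t₂) := by
    by_contra h; exact hne (gate_eq_of_not_disjoint h2 h)
  have hgq₁ := base_not_mem_gate hs hg t₁
  have hgq₂ := base_not_mem_gate hs hg t₂
  have hsp₁ := gateSide_gateFar_spec h2 ht₁ hgq₁
  have hsp₂ := gateSide_gateFar_spec h2 ht₂ hgq₂
  -- each gate lies on the near side of the other
  have key : ∀ {u v : ℝ}, u ∈ gateParams D Q → v ∈ gateParams D Q → IsGateOf D b hs g v →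
      Disjoint (gate D Q u) (gate D Q v) → gate D Q v ⊆ gateSide D Q g u := by
    intro u v hu hv hGv hduv
    have hgu := base_not_mem_gate hs hg u
    have hspu := gateSide_gateFar_spec h2 hu hgu
    have hcov : gate D Q v ⊆ gateSide D Q g u ∪ gateFar D Q g u := by
      rw [gateSide_union_gateFar]; exact fun z hz => ⟨gate_subset_carrier v hz, Set.disjoint_right.1 hduv hz⟩
    rcases (isPreconnected_gate v).subset_or_subset hspu.1 hspu.2.1 (disjoint_gateSide_gateFar g u) hcov with h | h
    · exact h
    · exfalso
      obtain ⟨q, hq⟩ := gate_nonempty h2 hv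
      have hqc : q ∈ closure (gateSide D Q g u) :=
        closure_mono (chamber_subset_gateSide hs hg u) (frontier_subset_closure (gate_subset_frontier_chamber hs hGv hq))
      exact Set.disjoint_left.1 ((disjoint_gateSide_gateFar g u).symm.closure_right hspu.2.1) (h hq) hqc
  have h21 : gate D Q t₂ ⊆ gateSide D Q g t₁ := key ht₁ ht₂ hG₂ hd
  have h12 : gate D Q t₁ ⊆ gateSide D Q g t₂ := key ht₂ ht₁ hG₁ hd.symm
  -- the far side of `t₂` lies on the near side of `t₁`
  have hcov : gateFar D Q g t₂ ⊆ gateSide D Q g t₁ ∪ gateFar D Q g t₁ := by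
    rw [gateSide_union_gateFar]
    intro z hz
    exact ⟨(gateFar_subset g t₂ hz).1, fun h => Set.disjoint_left.1 (disjoint_gateSide_gateFar g t₂) (h12 h) hz⟩
  rcases hsp₂.2.2.2.1.isPreconnected.subset_or_subset hsp₁.1 hsp₁.2.1 (disjoint_gateSide_gateFar g t₁) hcov with h | h
  · exact ((disjoint_gateSide_gateFar g t₁).mono_left h).symm
  · exfalso
    obtain ⟨q, hq⟩ := gate_nonempty h2 ht₂
    -- `q ∈ gate t₂ ⊆ closure (gateFar t₂)` and `q ∈ gateSide t₁` open: the two far sides meet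
    obtain ⟨w, hw₁, hw₂⟩ := mem_closure_iff_nhds.1 (gate_subset_closure_gateFar h2 ht₂ hgq₂ hq) _
      (hsp₁.1.mem_nhds (h21 hq))
    exact Set.disjoint_left.1 (disjoint_gateSide_gateFar g t₁) hw₁ (h hw₂)

end Decomposition

/-! ### The germ gate and the germ region -/

section Germ

variable (D : JordanDomain) (b : ℂ) {s : ℝ} (hs : 0 < s)

/-- The parameter of the **germ gate**: the gate of the chamber of `g` whose far side contains the
far point `o` (junk `0` if there is none). [folklore] -/
def germGateParam (g o : ℂ) : ℝ :=
  open scoped Classical in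
  if h : ∃ t₀, t₀ ∈ gateParams D (boxJD b hs) ∧ IsGateOf D b hs g t₀ ∧ o ∈ gateFar D (boxJD b hs) g t₀
  then h.choose else 0

/-- The **germ gate** `S`: the gate of the germ chamber separating it from the far point `o`
(Chelkak–Wan's arc `S_o(b,r)`, for boxes). [folklore] -/
def germGate (g o : ℂ) : Set ℂ := gate D (boxJD b hs) (germGateParam D b hs g o)

/-- The **germ region** `U`: the side of the germ gate containing the base point `g`
(Chelkak–Wan's `Ω_δ ∖ Ω_o(b,r)` read correctly: everything on `b`'s side of `S_o(b,r)`). [folklore] -/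
def germRegion (g o : ℂ) : Set ℂ := gateSide D (boxJD b hs) g (germGateParam D b hs g o)

/-- The **far region**: the far side of the germ gate (contains `o`). [folklore] -/
def germFar (g o : ℂ) : Set ℂ := gateFar D (boxJD b hs) g (germGateParam D b hs g o)

variable {D b hs} (h2 : TwoOff D (boxJD b hs)) {g o : ℂ} (hg : g ∈ D.carrier ∩ box b s)
  (ho : o ∈ D.carrier) (hoc : o ∉ closedBox b s)
include h2 hg ho hoc

/-- **Existence of the germ gate**: its parameter is mapped into `D`, it is a gate of the germ
chamber, and its far side contains `o`. [folklore] -/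
theorem germGateParam_spec : germGateParam D b hs g o ∈ gateParams D (boxJD b hs) ∧
    IsGateOf D b hs g (germGateParam D b hs g o) ∧ o ∈ germFar D b hs g o := by
  have hex : ∃ t₀, t₀ ∈ gateParams D (boxJD b hs) ∧ IsGateOf D b hs g t₀ ∧ o ∈ gateFar D (boxJD b hs) g t₀ := by
    obtain ⟨t₀, ht₀, hG, hfar⟩ := mem_gateFar_of_not_mem hs h2 hg ho
      (fun h => hoc (box_subset_closedBox b s (chamber_subset g h).2))
      (fun t₀ _ _ ⟨θ, _, hθ⟩ => hoc (hθ ▸ (boundary_boxJD_mem b hs θ).1))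
    exact ⟨t₀, ht₀, hG, hfar⟩
  have h := hex.choose_spec
  have e : germGateParam D b hs g o = hex.choose := by
    rw [germGateParam]; exact dif_pos hex
  rw [germFar, e]
  exact h

/-- **Uniqueness of the germ gate**: a gate of the germ chamber whose far side contains `o` is the
germ gate. [folklore] -/
theorem gate_eq_germGate {t₀ : ℝ} (ht₀ : t₀ ∈ gateParams D (boxJD b hs)) (hG : IsGateOf D b hs g t₀)
    (hot : o ∈ gateFar D (boxJD b hs) g t₀) : gate D (boxJD b hs) t₀ = germGate D b hs g o := by
  obtain ⟨hp, hGp, hop⟩ := germGateParam_spec h2 hg ho hoc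
  by_contra hne
  exact Set.disjoint_left.1 (disjoint_gateFar_of_ne hs h2 hg ht₀ hp hG hGp hne) hot hop

/-- The germ region is open. [folklore] -/
theorem isOpen_germRegion : IsOpen (germRegion D b hs g o) :=
  isOpen_gateSide h2 (germGateParam_spec h2 hg ho hoc).1 (base_not_mem_gate hs hg _)

/-- The germ region is connected. [folklore] -/
theorem isConnected_germRegion : IsConnected (germRegion D b hs g o) :=
  isConnected_gateSide h2 (germGateParam_spec h2 hg ho hoc).1 (base_not_mem_gate hs hg _)

/-- The far region is open. [folklore] -/
theorem isOpen_germFar : IsOpen (germFar D b hs g o) :=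
  isOpen_gateFar h2 (germGateParam_spec h2 hg ho hoc).1 (base_not_mem_gate hs hg _)

/-- The far region is connected. [folklore] -/
theorem isConnected_germFar : IsConnected (germFar D b hs g o) :=
  isConnected_gateFar h2 (germGateParam_spec h2 hg ho hoc).1 (base_not_mem_gate hs hg _)

omit h2 hg ho hoc in
/-- The germ region lies in `D`. [folklore] -/
theorem germRegion_subset_carrier : germRegion D b hs g o ⊆ D.carrier :=
  fun _ hz => (gateSide_subset g _ hz).1

omit h2 ho hoc in
/-- The germ chamber lies in the germ region. [folklore] -/
theorem chamber_subset_germRegion : chamber D b s g ⊆ germRegion D b hs g o :=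
  chamber_subset_gateSide hs hg _

omit h2 ho hoc in
/-- The base point lies in the germ region. [folklore] -/
theorem mem_germRegion : g ∈ germRegion D b hs g o := chamber_subset_germRegion hg (mem_chamber hg)

/-- The far point lies in the far region. [folklore] -/
theorem mem_germFar : o ∈ germFar D b hs g o := (germGateParam_spec h2 hg ho hoc).2.2

omit h2 hg ho hoc in
/-- The germ region and the far region are disjoint. [folklore] -/
theorem disjoint_germRegion_germFar : Disjoint (germRegion D b hs g o) (germFar D b hs g o) :=
  disjoint_gateSide_gateFar g _

omit h2 hg ho hoc in
/-- The germ region and the far region cover `D` minus the germ gate. [folklore] -/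
theorem germRegion_union_germFar :
    germRegion D b hs g o ∪ germFar D b hs g o = D.carrier \ germGate D b hs g o :=
  gateSide_union_gateFar

omit h2 hg ho hoc in
/-- The germ gate lies on the square. [folklore] -/
theorem germGate_subset_square : germGate D b hs g o ⊆ closedBox b s \ box b s := by
  rw [← range_boxJD_boundary b hs]; exact image_subset_range _ _

/-- The germ gate lies in the frontier of the germ chamber. [folklore] -/
theorem germGate_subset_frontier_chamber : germGate D b hs g o ⊆ frontier (chamber D b s g) :=
  gate_subset_frontier_chamber hs (germGateParam_spec h2 hg ho hoc).2.1

/-- The germ gate lies in the closure of the germ region. [folklore] -/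
theorem germGate_subset_closure_germRegion : germGate D b hs g o ⊆ closure (germRegion D b hs g o) :=
  gate_subset_closure_gateSide h2 (germGateParam_spec h2 hg ho hoc).1 (base_not_mem_gate hs hg _)

/-- The germ gate lies in the closure of the far region. [folklore] -/
theorem germGate_subset_closure_germFar : germGate D b hs g o ⊆ closure (germFar D b hs g o) :=
  gate_subset_closure_gateFar h2 (germGateParam_spec h2 hg ho hoc).1 (base_not_mem_gate hs hg _)

/-- The germ gate is nonempty. [folklore] -/
theorem germGate_nonempty : (germGate D b hs g o).Nonempty := gate_nonempty h2 (germGateParam_spec h2 hg ho hoc).1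

/-- **The frontier of the germ region inside `D` is the germ gate.** [folklore] -/
theorem carrier_inter_frontier_germRegion : D.carrier ∩ frontier (germRegion D b hs g o) = germGate D b hs g o := by
  obtain ⟨hp, hGp, hop⟩ := germGateParam_spec h2 hg ho hoc
  obtain ⟨-, -, -, -, σ, τ, -, -, -, hf, -⟩ := gateSide_gateFar_spec h2 hp (base_not_mem_gate hs hg _)
  apply Subset.antisymm
  · rintro z ⟨hzD, hz⟩
    rw [germRegion, hf] at hz
    rcases hz with hz | ⟨θ, -, rfl⟩
    · rw [germGate, gate_eq_gateArc_diff h2]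
      refine ⟨hz, ?_⟩
      rintro (h | h)
      · exact gateLo_not_mem h2 _ (show (boxJD b hs).boundary _ ∈ D.carrier by rw [← h]; exact hzD)
      · exact gateHi_not_mem h2 _ (show (boxJD b hs).boundary _ ∈ D.carrier by rw [← h]; exact hzD)
    · exfalso
      have hmem : D.boundary θ ∈ D.carrier ∩ frontier D.carrier := ⟨hzD, D.boundary_mem_frontier θ⟩
      rw [D.isOpen.inter_frontier_eq] at hmem
      exact hmem
  · intro z hz
    exact ⟨gate_subset_carrier _ hz, gateArc_subset_frontier_gateSide h2 hp (base_not_mem_gate hs hg _)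
      (gate_subset_gateArc _ hz)⟩

end Germ

/-! ### Nesting of germ regions -/

/-- **Germ regions are monotone in the scale**: for `s < s'` (same base point `g` in the small
box, same far point `o` off the large closed box) the germ region at scale `s` lies in the germ
region at scale `s'`. [folklore] -/
theorem germRegion_mono {D : JordanDomain} {b : ℂ} {s s' : ℝ} (hs : 0 < s) (hss' : s < s')
    (h2 : TwoOff D (boxJD b hs)) (h2' : TwoOff D (boxJD b (hs.trans hss')))
    {g o : ℂ} (hg : g ∈ D.carrier ∩ box b s) (ho : o ∈ D.carrier) (hoc : o ∉ closedBox b s') :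
    germRegion D b hs g o ⊆ germRegion D b (hs.trans hss') g o := by
  have hs' : 0 < s' := hs.trans hss'
  have hg' : g ∈ D.carrier ∩ box b s' := ⟨hg.1, box_mono hss'.le hg.2⟩
  have hoc_s : o ∉ closedBox b s := fun h => hoc (closedBox_mono hss'.le h)
  set S := germGate D b hs g o
  set S' := germGate D b hs' g o
  set V := germRegion D b hs g o
  set V' := germRegion D b hs' g o
  set W := germFar D b hs g o
  set W' := germFar D b hs' g o
  obtain ⟨hp, hGp, hop⟩ := germGateParam_spec h2 hg ho hoc_s
  obtain ⟨hp', hGp', hop'⟩ := germGateParam_spec h2' hg' ho hoc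
  -- the two gates are disjoint (different squares)
  have hSS' : Disjoint S S' := by
    refine Set.disjoint_left.2 fun z hz hz' => ?_
    have h1 := germGate_subset_square (hs := hs) (g := g) (o := o) hz
    have h2'' := germGate_subset_square (hs := hs') (g := g) (o := o) hz'
    exact h2''.2 (closedBox_subset_box hss' h1.1)
  -- chambers are nested
  have hGG' : chamber D b s g ⊆ chamber D b s' g :=
    connectedComponentIn_mono g (inter_subset_inter_right _ (box_mono hss'.le))
  -- (1) `S ⊆ V'`
  have hSV' : S ⊆ V' := by
    have hcov : S ⊆ V' ∪ W' := by
      rw [germRegion_union_germFar]; exact fun z hz => ⟨gate_subset_carrier _ hz, Set.disjoint_left.1 hSS' hz⟩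
    rcases (isPreconnected_gate _).subset_or_subset (isOpen_germRegion h2' hg' ho hoc) (isOpen_germFar h2' hg' ho hoc)
      disjoint_germRegion_germFar hcov with h | h
    · exact h
    · exfalso
      obtain ⟨q, hq⟩ := germGate_nonempty h2 hg ho hoc_s
      have hqc : q ∈ closure V' := closure_mono (hGG'.trans (chamber_subset_germRegion hg'))
        (frontier_subset_closure (germGate_subset_frontier_chamber h2 hg ho hoc_s hq))
      exact Set.disjoint_left.1 (disjoint_germRegion_germFar.symm.closure_right (isOpen_germFar h2' hg' ho hoc)) (h hq) hqc
  -- (2) `S' ⊆ W`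
  have hS'W : S' ⊆ W := by
    have hcov : S' ⊆ V ∪ W := by
      rw [germRegion_union_germFar]; exact fun z hz => ⟨gate_subset_carrier _ hz, Set.disjoint_right.1 hSS' hz⟩
    rcases (isPreconnected_gate _).subset_or_subset (isOpen_germRegion h2 hg ho hoc_s) (isOpen_germFar h2 hg ho hoc_s)
      disjoint_germRegion_germFar hcov with h | h
    · exfalso
      -- then `W' ⊆ V`, contradicting `o ∈ W' ∩ W`
      have hcovW : W' ⊆ V ∪ W := by
        rw [germRegion_union_germFar]
        intro z hz
        exact ⟨(gateFar_subset g _ hz).1, fun hzS => Set.disjoint_left.1 disjoint_germRegion_germFar (hSV' hzS) hz⟩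
      rcases (isConnected_germFar h2' hg' ho hoc).isPreconnected.subset_or_subset (isOpen_germRegion h2 hg ho hoc_s)
        (isOpen_germFar h2 hg ho hoc_s) disjoint_germRegion_germFar hcovW with h' | h'
      · exact Set.disjoint_left.1 disjoint_germRegion_germFar (h' hop') hop
      · obtain ⟨q, hq⟩ := germGate_nonempty h2' hg' ho hoc
        obtain ⟨w, hwV, hwW'⟩ := mem_closure_iff_nhds.1 (germGate_subset_closure_germFar h2' hg' ho hoc hq) _
          ((isOpen_germRegion h2 hg ho hoc_s).mem_nhds (h hq))
        exact Set.disjoint_left.1 disjoint_germRegion_germFar hwV (h' hwW')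
    · exact h
  -- (3) `V ⊆ D ∖ S'` is preconnected and contains `g`, so `V ⊆ V'`
  have hVD : V ⊆ D.carrier \ S' := fun z hz =>
    ⟨germRegion_subset_carrier hz, fun hzS' => Set.disjoint_left.1 disjoint_germRegion_germFar hz (hS'W hzS')⟩
  exact subset_gateSide_of_isPreconnected (isConnected_germRegion h2 hg ho hoc_s).isPreconnected hVD
    ⟨g, mem_germRegion hg, mem_germRegion (o := o) hg'⟩

/-! ### Metric containment of the germ region for small boxes -/

/-- A bounded open set whose frontier lies in a closed ball lies in that ball (leave along a ray).
[folklore] -/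
theorem subset_closedBall_of_frontier_subset {U : Set ℂ} (hU : IsOpen U) (hUb : Bornology.IsBounded U)
    {c : ℂ} {r : ℝ} (hf : frontier U ⊆ closedBall c r) : U ⊆ closedBall c r := by
  intro z hz
  by_contra hzr
  rw [mem_closedBall, not_le] at hzr
  by_cases hzc : z - c = 0
  · -- then `r < 0`: the frontier is empty, `U` is clopen hence everything, not bounded
    have hzc' : z = c := sub_eq_zero.1 hzc
    have hr : r < 0 := by rwa [hzc', dist_self] at hzr
    have hf0 : frontier U = ∅ := subset_empty_iff.1 fun w hw => by
      have := mem_closedBall.1 (hf hw); linarith [dist_nonneg (x := w) (y := c)]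
    have hcl : IsClopen U := isClopen_iff_frontier_eq_empty.2 hf0
    rcases isClopen_iff.1 hcl with h | h
    · rw [h] at hz; exact hz
    · exact IsJordanLoop.not_isBounded_image_ray z 1 one_ne_zero 0 (hUb.subset (by rw [h]; exact subset_univ _))
  set A : Set ℂ := (fun t : ℝ => z + t • (z - c)) '' Ici 0
  have hA : IsPreconnected A := IsJordanLoop.isPreconnected_image_ray z (z - c) 0
  have hAf : ∀ w ∈ A, w ∉ frontier U := by
    rintro _ ⟨t, ht, rfl⟩ hw
    have h1 := mem_closedBall.1 (hf hw)
    have ht0 : 0 ≤ t := mem_Ici.1 ht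
    have e : dist (z + t • (z - c)) c = (1 + t) * dist z c := by
      rw [dist_eq_norm, dist_eq_norm, show z + t • (z - c) - c = ((1 + t : ℝ) : ℂ) * (z - c) by
        rw [Complex.real_smul]; push_cast; ring, norm_mul, Complex.norm_real, Real.norm_eq_abs, abs_of_pos (by linarith)]
    rw [e] at h1
    nlinarith [dist_nonneg (x := z) (y := c)]
  have hcover : A ⊆ U ∪ (closure U)ᶜ := fun w hw => by
    by_cases h : w ∈ closure U
    · rw [closure_eq_interior_union_frontier, hU.interior_eq] at h
      exact Or.inl (h.resolve_right (hAf w hw))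
    · exact Or.inr h
  have hdisj : Disjoint U (closure U)ᶜ := disjoint_compl_right.mono_left subset_closure
  rcases hA.subset_or_subset hU isClosed_closure.isOpen_compl hdisj hcover with h | h
  · exact IsJordanLoop.not_isBounded_image_ray z (z - c) hzc 0 (hUb.subset h)
  · exact h ⟨0, mem_Ici.2 le_rfl, by simp⟩ (subset_closure hz)

/-- Integers near a number in `[0,1)`: `|x - k| < τ₀ ≤ 1/2` forces `x < τ₀` or `x > 1 - τ₀`. [folklore] -/
theorem lt_or_lt_of_abs_sub_int_lt {x τ₀ : ℝ} {k : ℤ} (hx0 : 0 ≤ x) (hx1 : x < 1) (hτ : τ₀ ≤ 1 / 2)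
    (h : |x - k| < τ₀) : x < τ₀ ∨ 1 - τ₀ < x := by
  obtain ⟨h1, h2⟩ := abs_lt.1 h
  have hk0 : 0 ≤ k := by
    by_contra hneg
    push Not at hneg
    have h' : k + 1 ≤ 0 := Int.lt_iff_add_one_le.1 hneg
    have : (k : ℝ) + 1 ≤ 0 := by exact_mod_cast h'
    linarith
  have hk1 : k ≤ 1 := by
    by_contra hgt
    push Not at hgt
    have : (2 : ℝ) ≤ k := by exact_mod_cast (Int.lt_iff_add_one_le.1 hgt : 1 + 1 ≤ k)
    linarith
  interval_cases k
  · left; push_cast at h2; linarith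
  · right; push_cast at h1; linarith

/-- **Small germ regions are metrically small.** Given `R > 0` there is `s₀ > 0` such that for every
scale `s ≤ s₀`, every base point `g` in the box and far point `o ∈ D` with `dist o b > R`, if `b`
is in the closure of the germ region (e.g. `g` is close to `b`, `mem_closure_germRegion`), then the
germ region lies in the closed ball of radius `R/2` about `b`: its frontier is the gate arc (in the
box) and the arc of `∂D` through `b` between the gate ends, whose parameters are within the
uniform-continuity modulus of that of `b` (inverse continuity of the boundary loop at the gate
ends); were it the long arc, the FAR region would be small and could not contain `o`. [folklore] -/
theorem exists_germRegion_subset_closedBall (D : JordanDomain) {R : ℝ} (hR : 0 < R) :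
    ∃ s₀ > 0, ∀ (b : ℂ) (s : ℝ) (hs : 0 < s), s ≤ s₀ → b ∈ frontier D.carrier →
      ∀ (h2 : TwoOff D (boxJD b hs)) (g o : ℂ), g ∈ D.carrier ∩ box b s → o ∈ D.carrier → R < dist o b →
      b ∈ closure (germRegion D b hs g o) → germRegion D b hs g o ⊆ closedBall b (R / 2) := by
  obtain ⟨τ₀, hτ₀, hτ₀h, hcont⟩ := D.exists_forall_dist_boundary_lt (show 0 < R / 4 by positivity)
  obtain ⟨m, hm, hsep⟩ := D.exists_int_abs_sub_lt_of_dist_lt hτ₀ hτ₀h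
  refine ⟨min (m / 4) (R / 16), lt_min (by positivity) (by positivity), ?_⟩
  intro b s hs hs₀ hb h2 g o hg ho hob hbc
  have hsm : 2 * s < m := by linarith [min_le_left (m / 4) (R / 16)]
  have hsR : 2 * s ≤ R / 8 := by linarith [min_le_right (m / 4) (R / 16)]
  have hoc : o ∉ closedBox b s := fun h => by
    have := closedBox_subset_closedBall h; rw [mem_closedBall] at this; linarith
  obtain ⟨hp, hGp, hop⟩ := germGateParam_spec h2 hg ho hoc
  obtain ⟨hVo, hWo, hVc, hWc, σ, τ, hστ, hτσ, hends, hfV, hfW⟩ :=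
    gateSide_gateFar_spec h2 hp (base_not_mem_gate hs hg (germGateParam D b hs g o))
  set Q := boxJD b hs
  set V := germRegion D b hs g o
  set W := germFar D b hs g o
  -- the gate ends are within `2s` of `b`
  have hend : ∀ z ∈ ({D.boundary σ, D.boundary τ} : Set ℂ), dist z b ≤ 2 * s := by
    intro z hz
    rw [hends] at hz
    have hz' : z ∈ closedBox b s := by
      rcases hz with rfl | rfl <;> exact (boundary_boxJD_mem b hs _).1
    exact mem_closedBall.1 (closedBox_subset_closedBall hz')
  have hσb : dist (D.boundary σ) b ≤ 2 * s := hend _ (Or.inl rfl)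
  have hτb : dist (D.boundary τ) b ≤ 2 * s := hend _ (Or.inr rfl)
  -- the gate arc is within `2s` of `b`
  have harc : gateArc D Q (germGateParam D b hs g o) ⊆ closedBall b (2 * s) := fun z hz => by
    obtain ⟨θ, -, rfl⟩ := hz
    exact closedBox_subset_closedBall (boundary_boxJD_mem b hs θ).1
  -- `b` is on the arc of `∂D` bounding `V`
  have hbV : b ∉ V := fun h => by
    have hmem : b ∈ D.carrier ∩ frontier D.carrier := ⟨germRegion_subset_carrier h, hb⟩
    rw [D.isOpen.inter_frontier_eq] at hmem; exact hmem
  have hbf : b ∈ frontier (gateSide D Q g (germGateParam D b hs g o)) := ⟨hbc, by rw [hVo.interior_eq]; exact hbV⟩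
  rw [hfV] at hbf
  have hbθ : ∃ θ ∈ Icc σ τ, D.boundary θ = b := by
    rcases hbf with h | ⟨θ, hθ, hθb⟩
    · exfalso
      obtain ⟨θ, -, hθ⟩ := h
      exact (boundary_boxJD_mem b hs θ).2 (by rw [hθ]; exact mem_box_self hs)
    · exact ⟨θ, hθ, hθb⟩
  obtain ⟨θ, hθ, hθb⟩ := hbθ
  -- parameters of the gate ends are close to `θ` modulo 1
  have hdσ : dist (D.boundary σ) (D.boundary θ) < m := by rw [hθb]; linarith
  have hdτ : dist (D.boundary θ) (D.boundary τ) < m := by rw [hθb, dist_comm]; linarith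
  obtain ⟨k₁, hk₁⟩ := hsep σ θ hdσ
  obtain ⟨k₂, hk₂⟩ := hsep θ τ hdτ
  have hc₁ := lt_or_lt_of_abs_sub_int_lt (x := θ - σ) (by linarith [hθ.1]) (by linarith [hθ.2]) hτ₀h
    (by rw [show θ - σ - (k₁ : ℝ) = θ - σ - k₁ by ring]; exact hk₁)
  have hc₂ := lt_or_lt_of_abs_sub_int_lt (x := τ - θ) (by linarith [hθ.2]) (by linarith [hθ.1]) hτ₀h
    (by rw [show τ - θ - (k₂ : ℝ) = τ - θ - k₂ by ring]; exact hk₂)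
  -- the contradiction when the far region is small
  have far_small : (∀ θ' ∈ Icc τ (σ + 1), dist (D.boundary θ') b < R / 4 + 2 * s) → False := by
    intro hsmall
    have hfW' : frontier W ⊆ closedBall b (R / 4 + 2 * s) := by
      rw [show frontier W = frontier (gateFar D Q g (germGateParam D b hs g o)) from rfl, hfW]
      rintro z (hz | ⟨θ', hθ', rfl⟩)
      · exact closedBall_subset_closedBall (by linarith) (harc hz)
      · exact mem_closedBall.2 (hsmall θ' hθ').le
    have hWsub := subset_closedBall_of_frontier_subset hWo (D.isBounded.subset fun z hz => (gateFar_subset g _ hz).1) hfW'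
    have := mem_closedBall.1 (hWsub hop)
    linarith
  rcases hc₂ with hc₂ | hc₂
  · rcases hc₁ with hc₁ | hc₁
    · -- both short: the arc through `b` is small, so `V` is small
      have hfV' : frontier V ⊆ closedBall b (R / 2) := by
        rw [show frontier V = frontier (gateSide D Q g (germGateParam D b hs g o)) from rfl, hfV]
        rintro z (hz | ⟨θ', hθ', rfl⟩)
        · exact closedBall_subset_closedBall (by linarith) (harc hz)
        · have h1 : |θ' - θ| ≤ τ₀ := abs_le.2 ⟨by linarith [hθ'.1], by linarith [hθ'.2]⟩
          have := hcont θ' θ h1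
          rw [hθb] at this
          exact mem_closedBall.2 (by linarith)
      exact subset_closedBall_of_frontier_subset hVo (D.isBounded.subset germRegion_subset_carrier) hfV'
    · -- `θ - σ > 1 - τ₀`: the complementary arc is short, near `D.boundary (σ+1) = D.boundary σ`
      exfalso
      refine far_small fun θ' hθ' => ?_
      have h1 : |θ' - (σ + 1)| ≤ τ₀ := abs_le.2 ⟨by linarith [hθ'.1, hθ.2], by linarith [hθ'.2]⟩
      have h2' := hcont θ' (σ + 1) h1
      rw [D.periodic_boundary σ] at h2'
      linarith [dist_triangle (D.boundary θ') (D.boundary σ) b]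
  · -- `τ - θ > 1 - τ₀`: the complementary arc is short, near `D.boundary τ`
    exfalso
    refine far_small fun θ' hθ' => ?_
    have h1 : |θ' - τ| ≤ τ₀ := abs_le.2 ⟨by linarith [hθ'.1], by linarith [hθ'.2, hθ.1]⟩
    have h2' := hcont θ' τ h1
    linarith [dist_triangle (D.boundary θ') (D.boundary τ) b]

/-! ### The germ: uniform local connectedness -/

/-- **Points of `D` near `b` lie in one chamber** (uniform local connectedness of Jordan domains,
Newman VI.14·1): for every scale `s` there is `η ∈ (0, s/2]` such that for every centre `b` and
base point `g ∈ D` within `η` of `b`, all of `D ∩ ball b η` lies in the chamber of `g` in `box b s`.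
[cite: Newman1939, Ch. VI §14 Thm. 14·1 p. 161] -/
theorem exists_ball_inter_subset_chamber (D : JordanDomain) {s : ℝ} (hs : 0 < s) :
    ∃ η > 0, η ≤ s / 2 ∧ ∀ b g : ℂ, g ∈ D.carrier → dist g b < η → D.carrier ∩ ball b η ⊆ chamber D b s g := by
  obtain ⟨η₀, hη₀, hulc⟩ := D.uniformlyLocallyConnected (half_pos hs)
  refine ⟨min (η₀ / 2) (s / 4), lt_min (by positivity) (by positivity), by linarith [min_le_right (η₀ / 2) (s / 4)], ?_⟩
  intro b g hg hgb y ⟨hy, hyb⟩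
  have hη₁ := min_le_left (η₀ / 2) (s / 4)
  have hη₂ := min_le_right (η₀ / 2) (s / 4)
  rw [mem_ball] at hyb
  have hgy : dist g y < η₀ := by linarith [dist_triangle g b y, dist_comm b y]
  obtain ⟨S, hS, hSpre, hgS, hyS⟩ := hulc g hg y hy hgy
  have hSbox : S ⊆ D.carrier ∩ box b s := fun z hz => by
    refine ⟨(hS hz).1, ball_subset_box ?_⟩
    have := (hS hz).2; rw [mem_ball] at this ⊢
    linarith [dist_triangle z g b]
  have hgbox : g ∈ box b s := ball_subset_box (show g ∈ ball b s by rw [mem_ball]; linarith)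
  exact subset_chamber_of_isPreconnected hSpre hSbox ⟨g, hgS, mem_chamber ⟨hg, hgbox⟩⟩ hyS

/-- If `D` accumulates at `b` and `g ∈ D` is within the germ radius of `b`, then `b` lies in the
closure of the chamber of `g`. [folklore] -/
theorem mem_closure_chamber {D : JordanDomain} {b g : ℂ} {s η : ℝ} (hb : b ∈ closure D.carrier)
    (hη : 0 < η) (hsub : D.carrier ∩ ball b η ⊆ chamber D b s g) : b ∈ closure (chamber D b s g) := by
  refine closure_mono hsub (mem_closure_iff_nhds.2 fun t ht => ?_)
  obtain ⟨z, ⟨hzt, hzB⟩, hzD⟩ := mem_closure_iff_nhds.1 hb (t ∩ ball b η) (inter_mem ht (ball_mem_nhds b hη))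
  exact ⟨z, hzt, hzD, hzB⟩

/-- Under the same hypotheses `b` lies in the closure of the germ region. [folklore] -/
theorem mem_closure_germRegion {D : JordanDomain} {b g o : ℂ} {s η : ℝ} (hs : 0 < s) (hb : b ∈ closure D.carrier)
    (hg : g ∈ D.carrier ∩ box b s) (hη : 0 < η) (hsub : D.carrier ∩ ball b η ⊆ chamber D b s g) :
    b ∈ closure (germRegion D b hs g o) :=
  closure_mono (chamber_subset_germRegion hg) (mem_closure_chamber hb hη hsub)

end Literature.Topology.PlaneTopology
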